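import Literature.NumberTheory.EllipticCurves.GlobalMinimalModelProofs
import Literature.NumberTheory.EllipticCurves.RootNumberSmulProofs
import Summits.ABC.ABC.Theorems.SomeWindowSaving.Negative.Defs

/-!
# Route TwistAmplification — support item `TwistAmplificationLemma` (stmt-ABC-1978):
  integral reduction of a Weierstrass model

Helper file for the proof of `Summit.ABC.ABC.Theses.TwistAmplification.TwistAmplificationLemma`.
The window count of the route only sees REDUCED integral models (`a₁, a₃ ∈ {0,1}`,
`a₂ ∈ {-1,0,1}`).  Every integral model `W / ℤ` has an integral translate `C • W`,
`C = (1; r, s, t)`, which is reduced; since `u = 1` the covariants `c₄, c₆, Δ` are unchanged, and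
since `r, s, t ∈ ℤ` minimality at every finite place and the conductor are unchanged
(`isMinimal_adicCompletion_smul`, `conductorNorm_smul` of the Literature).  Packaged as
`TwistAmplificationLemma.exists_reduced_model`.
-/

-- `Summit.<Summit>.<Problem>` is the mandated summit-side namespace (CONVENTIONS §2); for the
-- single-conjunct summit `ABC` the two coincide, so the duplicate `ABC.ABC` is deliberate.
set_option linter.dupNamespace false

namespace Summit.ABC.ABC.Theorems

open WeierstrassCurve IsDedekindDomain

/-- Arithmetic of the reducing shifts: `A − 3⌊(A+1)/3⌋ ∈ {−1, 0, 1}`. -/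
theorem TwistAmplificationLemma.sub_three_mul_ediv_mem (A : ℤ) :
    A + 3 * (-((A + 1) / 3)) = -1 ∨ A + 3 * (-((A + 1) / 3)) = 0 ∨
      A + 3 * (-((A + 1) / 3)) = 1 := by
  omega

/-- Arithmetic of the reducing shifts: `B − 2⌊B/2⌋ ∈ {0, 1}`. -/
theorem TwistAmplificationLemma.sub_two_mul_ediv_mem (B : ℤ) :
    B + 2 * (-(B / 2)) = 0 ∨ B + 2 * (-(B / 2)) = 1 := by
  omega

/-- **Integral reduction.** Every Weierstrass model over `ℤ` has an integral translate
`C • W`, `C = (1; r, s, t)` with `r s t : ℤ`, which is reduced: `a₁, a₃ ∈ {0, 1}` and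
`a₂ ∈ {−1, 0, 1}` (choose `s`, then `r`, then `t` by Euclidean division). -/
theorem TwistAmplificationLemma.exists_variableChange_reduced (W : WeierstrassCurve ℤ) :
    ∃ C : VariableChange ℤ, C.u = 1 ∧ ((C • W).a₁ = 0 ∨ (C • W).a₁ = 1) ∧
      ((C • W).a₃ = 0 ∨ (C • W).a₃ = 1) ∧
      ((C • W).a₂ = -1 ∨ (C • W).a₂ = 0 ∨ (C • W).a₂ = 1) := by
  set s : ℤ := -(W.a₁ / 2) with hs
  set r : ℤ := -((W.a₂ - s * W.a₁ - s ^ 2 + 1) / 3) with hr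
  set t : ℤ := -((W.a₃ + r * W.a₁) / 2) with ht
  refine ⟨⟨1, r, s, t⟩, rfl, ?_, ?_, ?_⟩
  · have h := TwistAmplificationLemma.sub_two_mul_ediv_mem W.a₁
    simp only [variableChange_a₁, inv_one, Units.val_one, one_mul]
    rw [hs] at *
    omega
  · have h := TwistAmplificationLemma.sub_two_mul_ediv_mem (W.a₃ + r * W.a₁)
    simp only [variableChange_a₃, inv_one, Units.val_one, one_pow, one_mul]
    rw [ht]
    omega
  · have h := TwistAmplificationLemma.sub_three_mul_ediv_mem (W.a₂ - s * W.a₁ - s ^ 2)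
    simp only [variableChange_a₂, inv_one, Units.val_one, one_pow, one_mul]
    rw [hr]
    omega

/-- **Reduced model of a minimal integral model.**  For an integral model `W₁ / ℤ` whose base
change to `ℚ` is elliptic and minimal at every finite place there is a REDUCED integral model
`W₂` (`a₁, a₃ ∈ {0,1}`, `a₂ ∈ {−1,0,1}`) with the same `c₄`, `c₆`, `Δ`, again elliptic and
minimal at every place, and with the same conductor (an integral translate `(1; r, s, t) • W₁`:
`u = 1` fixes the covariants, integrality of `r, s, t` preserves minimality, and the conductor is an
isomorphism invariant). -/
theorem TwistAmplificationLemma.exists_reduced_model (W₁ : WeierstrassCurve ℤ)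
    (hE : (W₁.baseChange ℚ).IsElliptic)
    (hmin : ∀ v : HeightOneSpectrum ℤ, (W₁.baseChange ℚ).IsMinimalAt v) :
    ∃ W₂ : WeierstrassCurve ℤ, (W₂.baseChange ℚ).IsElliptic ∧
      (∀ v : HeightOneSpectrum ℤ, (W₂.baseChange ℚ).IsMinimalAt v) ∧
      (W₂.a₁ = 0 ∨ W₂.a₁ = 1) ∧ (W₂.a₃ = 0 ∨ W₂.a₃ = 1) ∧
      (W₂.a₂ = -1 ∨ W₂.a₂ = 0 ∨ W₂.a₂ = 1) ∧
      W₂.c₄ = W₁.c₄ ∧ W₂.c₆ = W₁.c₆ ∧ W₂.Δ = W₁.Δ ∧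
      (W₂.baseChange ℚ).conductorNorm ℤ = (W₁.baseChange ℚ).conductorNorm ℤ := by
  obtain ⟨C, hu, h₁, h₃, h₂⟩ := TwistAmplificationLemma.exists_variableChange_reduced W₁
  haveI := hE
  have hbc : (C • W₁).baseChange ℚ = (C.map (algebraMap ℤ ℚ)) • (W₁.baseChange ℚ) := by
    simp only [baseChange, map_variableChange]
  refine ⟨C • W₁, ?_, ?_, h₁, h₃, h₂, ?_, ?_, ?_, ?_⟩
  · rw [hbc]; infer_instance
  · intro v
    have hu' : ((C.map (algebraMap ℤ ℚ)).u : ℚ) = algebraMap ℤ ℚ 1 := by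
      simp [VariableChange.map, hu]
    have h := isMinimal_adicCompletion_smul (hmin v) (C.map (algebraMap ℤ ℚ))
      (by rw [hu', map_one, map_one]) (v.valuation_le_one C.r)
      (v.valuation_le_one C.s) (v.valuation_le_one C.t)
    simpa only [IsMinimalAt, hbc] using h
  · rw [variableChange_c₄, hu]; simp
  · rw [variableChange_c₆, hu]; simp
  · rw [variableChange_Δ, hu]; simp
  · rw [hbc]
    exact conductorNorm_smul ℤ (W₁.baseChange ℚ) _

end Summit.ABC.ABC.Theorems
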